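import Mathlib
import Literature.Analysis.FluidPDE.TypeIAncientMild
import Literature.Analysis.FluidPDE.OseenBallAverageMomentum
import Summits.NavierStokesRegularity.NavierStokesRegularity.Theses.SymmetryModuliCount
import Summits.NavierStokesRegularity.NavierStokesRegularity.Theorems.ScenarioCensusRowA7h
import HarnessLib

/-!
# Census rows A7st / A7uv (stratified / uniform vertical velocity, KNSS-gauge Type-I ancient) — part 1/2: cells, rows, lattice, F1 flux lemma

Re-homed for the scenario census (typer seat ns-census-typer-1 g5; lead g7 MINT INTENT addendum A7st 17:28Z [2/2], OFFER 17:30Z) from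
ns-idea-2 g10/g11's LINE «strat-drift» REV 4 (`pub/ideators/ns-idea-2/lines/strat-drift/line-strat-drift.lean`, sha16 d45f1cf91f78b2fd, 530 l.,
SORRY-FREE; crit RE-STAMPs REV 2/3; lit §21.15 NOT IN PRINT), in two files for the 400-line rule: `ScenarioCensusRowA7stFlux` (§1–§3a: the
cells `IsVertStratified` / `IsUniformVertical`, rows `Row_A7st` / `Row_A7uv`, lattice to A7h, F1 `FluxLemma` PROVED via `uniform_of_stratified`)
→ `ScenarioCensusRowA7st` (§3b–§4: D1 `DriftConstancy` / D1L `DriftConstancyL` PROVED via `meanDrift_holds` — KNSS 2009 §4 «the Oseen–Duhamel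
term does not see constants», tree `OseenBallAverageMomentum` — compositions, `row_A7st_holds`, `row_A7uv_holds`; census keys).  Lean text
verbatim in namespace `…Theorems.ScenarioCensus.StratDrift` (the line's `…Lines.StratDrift` re-homed; `R3` notation spelled out; the `stub_*` aliases dropped (the (L′) bridge
`row_A7st_of_typeIAncientLiouville` kept, lead 17:31Z); docstrings added where missing).

No census value is asserted here (the lead books A7st / A7uv); NS regularity is NOT proved; (L′), A1, A2 stay OPEN; no summit statement
is proved by this file.
-/

noncomputable section

set_option linter.unusedVariables false
set_option linter.style.longLine false
set_option linter.dupNamespace false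

namespace Summit.NavierStokesRegularity.NavierStokesRegularity.Theorems.ScenarioCensus.StratDrift

open Set Function Filter Topology MeasureTheory
open scoped Interval
open Literature.Analysis Literature.Analysis.FluidPDE
open Summit.NavierStokesRegularity.NavierStokesRegularity
open Summit.NavierStokesRegularity.NavierStokesRegularity.Theorems.ScenarioCensus
open Summit.NavierStokesRegularity.NavierStokesRegularity.Theorems.ScenarioCensus.HorizontalMeter (IsHorizontalValued)


/-! ## 1. The cells -/

/-- STRATIFIED vertical velocity: `u₃(t,x)` depends only on `(t, x₃)`. -/
def IsVertStratified (u : ℝ → (EuclideanSpace ℝ (Fin 3)) → (EuclideanSpace ℝ (Fin 3))) : Prop :=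
  ∀ t < 0, ∀ x y : (EuclideanSpace ℝ (Fin 3)), x 2 = y 2 → u t x 2 = u t y 2

/-- UNIFORM vertical drift: `u₃(t,·)` is spatially constant for each `t < 0`. -/
def IsUniformVertical (u : ℝ → (EuclideanSpace ℝ (Fin 3)) → (EuclideanSpace ℝ (Fin 3))) : Prop :=
  ∀ t < 0, ∀ x y : (EuclideanSpace ℝ (Fin 3)), u t x 2 = u t y 2

/-- Uniform vertical drift is stratified. -/
theorem isVertStratified_of_isUniformVertical {u : ℝ → (EuclideanSpace ℝ (Fin 3)) → (EuclideanSpace ℝ (Fin 3))} (h : IsUniformVertical u) :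
    IsVertStratified u := fun t ht x y _ => h t ht x y

/-- Horizontal-valued fields have uniform (zero) vertical drift. -/
theorem isUniformVertical_of_isHorizontalValued {u : ℝ → (EuclideanSpace ℝ (Fin 3)) → (EuclideanSpace ℝ (Fin 3))} (h : IsHorizontalValued u) :
    IsUniformVertical u := fun t ht x y => by rw [h t ht x, h t ht y]

/-- **Row A7st** (proposed): the stratified-vertical-velocity cell of the genuine KNSS-gauge Type-I ancient class is `{0}`. -/
def Row_A7st : Prop :=
  ∀ (C : ℝ) (u : ℝ → (EuclideanSpace ℝ (Fin 3)) → (EuclideanSpace ℝ (Fin 3))), IsTypeIAncientMild C u → IsVertStratified u → ∀ t < 0, ∀ x, u t x = 0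

/-- **Row A7uv** (proposed sub-row): the uniform-vertical-drift cell is `{0}`. -/
def Row_A7uv : Prop :=
  ∀ (C : ℝ) (u : ℝ → (EuclideanSpace ℝ (Fin 3)) → (EuclideanSpace ℝ (Fin 3))), IsTypeIAncientMild C u → IsUniformVertical u → ∀ t < 0, ∀ x, u t x = 0

/-! ## 2. Lattice placement (PROVED) -/

/-- Lattice: A7st ⇒ A7uv. -/
theorem row_A7uv_of_row_A7st (h : Row_A7st) : Row_A7uv :=
  fun C u hu hv => h C u hu (isVertStratified_of_isUniformVertical hv)

/-- Lattice: A7uv ⇒ A7h. -/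
theorem row_A7h_of_row_A7uv (h : Row_A7uv) : Row_A7h :=
  fun C u hu hh => h C u hu (isUniformVertical_of_isHorizontalValued hh)


/-- Bridge BY NAME from the A-block hard core (L′) = `Theses.SymmetryModuliCount.TypeIAncientLiouville` (zero movement on (L′)). -/
theorem row_A7st_of_typeIAncientLiouville (h : Theses.SymmetryModuliCount.TypeIAncientLiouville) : Row_A7st :=
  fun C u hu _ => h C u (isTypeIAncientMild_iff.1 hu)

/-! ## 3. Obligations -/

/-- **F1 `FluxLemma`** (obligation; elementary vector calculus, S/M-sized in Lean — Fubini on a square + FTC): for a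
KNSS-gauge Type-I ancient field with stratified vertical velocity, `u₃(t,·)` is spatially CONSTANT.  Mechanism: on the
plane `{x₃ = h}` the planar divergence `∂₁u₁ + ∂₂u₂ = −w′(h)` is constant; integrating over `[−R,R]²` and using
`sup|u(t)| ≤ C/√(−t)` gives `|w′(h)|·4R² ≤ 8R·C/√(−t)` for every `R`, so `w′ ≡ 0`.  Why it might fail: only by
mis-typing (it uses just smooth + bounded + divergence-free slices).  Source: folklore (flux / divergence theorem);
cf. KNSS 2009 §5 (arXiv:0709.3599) for the 2D reductions. -/
def FluxLemma : Prop :=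
  ∀ (C : ℝ) (u : ℝ → (EuclideanSpace ℝ (Fin 3)) → (EuclideanSpace ℝ (Fin 3))), IsTypeIAncientMild C u → IsVertStratified u → IsUniformVertical u

/-- **Pure-calculus core of F1** (PROVED, REV 2): a `C¹` field `v : (EuclideanSpace ℝ (Fin 3)) → (EuclideanSpace ℝ (Fin 3))`, bounded, divergence-free, whose third
component is stratified (`x₂ = y₂ ⇒ v₂ x = v₂ y`, coordinates `0,1,2`), has spatially CONSTANT third component.
Proof: `div v = ∂₀v₀ + ∂₁v₁ + ∂₂v₂` (`divergence_eq_sum_inner_fderiv`); `∂₂v₂` depends only on the height; Green's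
formula on the square `[-R,R]²` of the plane `{x₂ = h}` (Mathlib `integral2_divergence_prod_of_hasFDerivAt`) gives
`4R²·|∂₂v₂(h)| ≤ 8R·B`, so `∂₂v₂ ≡ 0`; then `v₂` is constant along `e₂` (`is_const_of_deriv_eq_zero`) and stratified,
hence constant. [folklore: flux / divergence theorem] -/
theorem uniform_of_stratified {v : (EuclideanSpace ℝ (Fin 3)) → (EuclideanSpace ℝ (Fin 3))} {B : ℝ} (hcd : ContDiff ℝ 1 v)
    (hB : ∀ x, ‖v x‖ ≤ B) (hdiv : ∀ x, VectorCalculus.divergence v x = 0)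
    (hstrat : ∀ x y : (EuclideanSpace ℝ (Fin 3)), x 2 = y 2 → v x 2 = v y 2) :
    ∀ x y : (EuclideanSpace ℝ (Fin 3)), v x 2 = v y 2 := by
  -- basis vectors and regularity
  set e : Fin 3 → (EuclideanSpace ℝ (Fin 3)) := fun i => EuclideanSpace.single i (1 : ℝ) with he
  have hdiff : Differentiable ℝ v := hcd.differentiable one_ne_zero
  have hvc : Continuous v := hcd.continuous
  have he_apply : ∀ (i j : Fin 3) (c : ℝ), (c • e i) j = if j = i then c else 0 := by
    intro i j c
    simp [he]
  -- (1) `div v = ∂₀v₀ + ∂₁v₁ + ∂₂v₂ = 0`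
  have hsum : ∀ x, (fderiv ℝ v x (e 0)) 0 + (fderiv ℝ v x (e 1)) 1 + (fderiv ℝ v x (e 2)) 2 = 0 := by
    intro x
    have h := hdiv x
    rw [divergence_eq_sum_inner_fderiv (EuclideanSpace.basisFun (Fin 3) ℝ)] at h
    simpa [Fin.sum_univ_three, EuclideanSpace.basisFun_apply, EuclideanSpace.inner_single_left,
      he] using h
  -- (2) the line derivative of `v₂` along `e 2`
  have hline : ∀ (x : (EuclideanSpace ℝ (Fin 3))) (s₀ : ℝ),
      HasDerivAt (fun s : ℝ => v (x + s • e 2) 2) ((fderiv ℝ v (x + s₀ • e 2) (e 2)) 2) s₀ := by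
    intro x s₀
    have h1 : HasDerivAt (fun s : ℝ => x + s • e 2) (e 2) s₀ := by
      simpa using ((hasDerivAt_id s₀).smul_const (e 2)).const_add x
    have h2 : HasDerivAt (fun s : ℝ => v (x + s • e 2)) (fderiv ℝ v (x + s₀ • e 2) (e 2)) s₀ :=
      (hdiff (x + s₀ • e 2)).hasFDerivAt.comp_hasDerivAt s₀ h1
    have h3 := (EuclideanSpace.proj (2 : Fin 3)).hasFDerivAt.comp_hasDerivAt s₀ h2
    simpa [Function.comp_def] using h3
  -- (3) `∂₂v₂` depends only on the height
  have hD22 : ∀ x y : (EuclideanSpace ℝ (Fin 3)), x 2 = y 2 → (fderiv ℝ v x (e 2)) 2 = (fderiv ℝ v y (e 2)) 2 := by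
    intro x y hxy
    have hfun : (fun s : ℝ => v (x + s • e 2) 2) = fun s => v (y + s • e 2) 2 := by
      funext s
      apply hstrat
      simp [he_apply, hxy]
    have hx := (hline x 0).deriv
    have hy := (hline y 0).deriv
    rw [hfun] at hx
    simp only [zero_smul, add_zero] at hx hy
    rw [← hx, ← hy]
  -- (4) the flux identity on squares forces `∂₂v₂ ≡ 0`
  have hB0 : 0 ≤ B := (norm_nonneg _).trans (hB 0)
  have hcomp_le : ∀ (x : (EuclideanSpace ℝ (Fin 3))) (i : Fin 3), |v x i| ≤ B := fun x i =>
    ((Real.norm_eq_abs _).symm.le.trans (PiLp.norm_apply_le (v x) i)).trans (hB x)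
  have hzero : ∀ z : (EuclideanSpace ℝ (Fin 3)), (fderiv ℝ v z (e 2)) 2 = 0 := by
    intro z
    set α : ℝ := (fderiv ℝ v z (e 2)) 2 with hα
    set h : ℝ := z 2 with hh
    -- the affine chart of the plane `{x₂ = h}`
    set Q : ℝ × ℝ → (EuclideanSpace ℝ (Fin 3)) := fun p => p.1 • e 0 + p.2 • e 1 + h • e 2 with hQ
    have hQ2 : ∀ p, Q p 2 = h := by intro p; simp [hQ, he_apply]
    have hQc : Continuous Q := by
      simp only [hQ]; fun_prop
    set L : ℝ × ℝ →L[ℝ] (EuclideanSpace ℝ (Fin 3)) :=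
      (ContinuousLinearMap.fst ℝ ℝ ℝ).smulRight (e 0) + (ContinuousLinearMap.snd ℝ ℝ ℝ).smulRight (e 1)
      with hL
    have hQd : ∀ p, HasFDerivAt Q L p := fun p =>
      ((hasFDerivAt_fst.smul_const (e 0)).add (hasFDerivAt_snd.smul_const (e 1))).add_const (h • e 2)
    set f : ℝ × ℝ → ℝ := fun p => v (Q p) 0 with hf
    set g : ℝ × ℝ → ℝ := fun p => v (Q p) 1 with hg
    set f' : ℝ × ℝ → ℝ × ℝ →L[ℝ] ℝ :=
      fun p => (EuclideanSpace.proj (0 : Fin 3)).comp ((fderiv ℝ v (Q p)).comp L) with hf'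
    set g' : ℝ × ℝ → ℝ × ℝ →L[ℝ] ℝ :=
      fun p => (EuclideanSpace.proj (1 : Fin 3)).comp ((fderiv ℝ v (Q p)).comp L) with hg'
    have Hf : ∀ p, HasFDerivAt f (f' p) p := by
      intro p
      have H := (EuclideanSpace.proj (𝕜 := ℝ) (0 : Fin 3)).hasFDerivAt.comp p
        ((hdiff (Q p)).hasFDerivAt.comp p (hQd p))
      simpa [hf, hf', Function.comp_def] using H
    have Hg : ∀ p, HasFDerivAt g (g' p) p := by
      intro p
      have H := (EuclideanSpace.proj (𝕜 := ℝ) (1 : Fin 3)).hasFDerivAt.comp p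
        ((hdiff (Q p)).hasFDerivAt.comp p (hQd p))
      simpa [hg, hg', Function.comp_def] using H
    have hfc : Continuous f := (EuclideanSpace.proj (0 : Fin 3)).continuous.comp (hvc.comp hQc)
    have hgc : Continuous g := (EuclideanSpace.proj (1 : Fin 3)).continuous.comp (hvc.comp hQc)
    have hL10 : L (1, 0) = e 0 := by simp [hL]
    have hL01 : L (0, 1) = e 1 := by simp [hL]
    have key : ∀ p, f' p (1, 0) + g' p (0, 1) = -α := by
      intro p
      have h1 : f' p (1, 0) = (fderiv ℝ v (Q p) (e 0)) 0 := by
        simp only [hf', ContinuousLinearMap.comp_apply, hL10]; rfl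
      have h2 : g' p (0, 1) = (fderiv ℝ v (Q p) (e 1)) 1 := by
        simp only [hg', ContinuousLinearMap.comp_apply, hL01]; rfl
      have h3 := hsum (Q p)
      have h4 : (fderiv ℝ v (Q p) (e 2)) 2 = α := hD22 (Q p) z (by rw [hQ2, hh])
      rw [h1, h2]; linarith
    have hkeyfun : (fun p => f' p (1, 0) + g' p (0, 1)) = fun _ => -α := funext key
    -- Green's formula on the square `[-R, R]²`
    have hflux : ∀ R : ℝ, 0 < R → 4 * R ^ 2 * |α| ≤ 8 * R * B := by
      intro R hR
      have Hi : IntegrableOn (fun p => f' p (1, 0) + g' p (0, 1))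
          ([[-R, R]] ×ˢ [[-R, R]]) volume := by
        rw [hkeyfun]
        exact continuousOn_const.integrableOn_compact (isCompact_uIcc.prod isCompact_uIcc)
      have hG := MeasureTheory.integral2_divergence_prod_of_hasFDerivAt f g f' g' (-R) (-R) R R
        hfc.continuousOn hgc.continuousOn (fun p _ => Hf p) (fun p _ => Hg p) Hi
      have hlhs : (∫ x in (-R)..R, ∫ y in (-R)..R, f' (x, y) (1, 0) + g' (x, y) (0, 1))
          = -(4 * R ^ 2 * α) := by
        simp_rw [key, intervalIntegral.integral_const, smul_eq_mul]; ring
      have hbd : ∀ (w : ℝ → ℝ), (∀ s, |w s| ≤ B) → |∫ s in (-R)..R, w s| ≤ 2 * R * B := by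
        intro w hw
        have := intervalIntegral.norm_integral_le_of_norm_le_const (a := -R) (b := R) (C := B)
          (f := w) (fun s _ => by simpa [Real.norm_eq_abs] using hw s)
        rw [Real.norm_eq_abs] at this
        calc |∫ s in (-R)..R, w s| ≤ B * |R - -R| := this
          _ = 2 * R * B := by rw [sub_neg_eq_add, abs_of_pos (by linarith)]; ring
      have b1 := hbd (fun x => g (x, R)) (fun s => hcomp_le _ 1)
      have b2 := hbd (fun x => g (x, -R)) (fun s => hcomp_le _ 1)
      have b3 := hbd (fun y => f (R, y)) (fun s => hcomp_le _ 0)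
      have b4 := hbd (fun y => f (-R, y)) (fun s => hcomp_le _ 0)
      rw [hlhs] at hG
      have habs : |-(4 * R ^ 2 * α)| ≤ 8 * R * B := by
        rw [hG]
        calc |(((∫ x in (-R)..R, g (x, R)) - ∫ x in (-R)..R, g (x, -R)) + ∫ y in (-R)..R, f (R, y)) -
              ∫ y in (-R)..R, f (-R, y)|
            ≤ |∫ x in (-R)..R, g (x, R)| + |∫ x in (-R)..R, g (x, -R)| + |∫ y in (-R)..R, f (R, y)| +
              |∫ y in (-R)..R, f (-R, y)| := by
              refine (abs_sub _ _).trans ?_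
              refine add_le_add ((abs_add_le _ _).trans (add_le_add (abs_sub _ _) le_rfl)) le_rfl
          _ ≤ 2 * R * B + 2 * R * B + 2 * R * B + 2 * R * B := by gcongr
          _ = 8 * R * B := by ring
      rw [abs_neg, abs_mul, abs_of_pos (by positivity : (0:ℝ) < 4 * R ^ 2)] at habs
      exact habs
    -- let `R → ∞`
    by_contra hne
    have hapos : 0 < |α| := abs_pos.2 hne
    set R : ℝ := 2 * B / |α| + 1 with hR
    have hRpos : 0 < R := by positivity
    have h1 := hflux R hRpos
    have h2 : R * |α| ≤ 2 * B := by
      have : 4 * R * (R * |α|) ≤ 4 * R * (2 * B) := by nlinarith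
      exact le_of_mul_le_mul_left this (by positivity)
    have h3 : R * |α| = 2 * B + |α| := by
      rw [hR]; field_simp
    linarith
  -- (5) `v₂` is constant along `e 2`, hence constant
  set w : ℝ → ℝ := fun s => v ((0 : (EuclideanSpace ℝ (Fin 3))) + s • e 2) 2 with hw
  have hwd : ∀ s, HasDerivAt w 0 s := by
    intro s
    have := hline 0 s
    rwa [hzero] at this
  have hwconst : ∀ a b : ℝ, w a = w b :=
    is_const_of_deriv_eq_zero (fun s => (hwd s).differentiableAt) (fun s => (hwd s).deriv)
  have hvw : ∀ x : (EuclideanSpace ℝ (Fin 3)), v x 2 = w (x 2) := by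
    intro x
    apply hstrat
    simp [he_apply]
  intro x y
  rw [hvw x, hvw y, hwconst (x 2) (y 2)]

/-- **F1 PROVED (REV 2)** from the pure-calculus core `uniform_of_stratified` and the tree API of the class
(`contDiff_slice`, `norm_le`, `isDivFree`). -/
theorem fluxLemma_holds : FluxLemma := by
  intro C u hu hv t ht x y
  have hcd : ContDiff ℝ 1 (u t) := (hu.contDiff_slice ht).of_le (by exact_mod_cast le_top)
  exact uniform_of_stratified hcd (fun z => hu.norm_le ht z) (hu.isDivFree ht) (hv t ht) x y


end Summit.NavierStokesRegularity.NavierStokesRegularity.Theorems.ScenarioCensus.StratDrift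

end
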